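import Literature.MathematicalPhysics.QuantumManyBody.PeriodicBoseGasLocalization
import Mathlib.Analysis.Calculus.Deriv.MeanValue
import HarnessLib

/-!
# `χ*χ ≥ 1 - C|y|²`: the sharp lower bound on the self-convolution of the localisation function

Topic `Literature/MathematicalPhysics/QuantumManyBody` (provefact
`Literature.MathematicalPhysics.QuantumManyBody.BoseGas.Fournais2020_condensation`, layer `Fournais2020_lemma24`).
In the proof of [Fournais2020, Lemma 2.4] the localised potential `W₁ = g/(χ*χ)(x/ℓ)` (2.8) is
compared with `g` through "`0 ≤ W₁(x) ≤ (1 + C(R/ℓ)²) g(x)`, using (2.8) and a simple bound on the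
convolution (recall that `supp v ⊂ B(0,R)`)" [Fournais2020, before (2.42)]; the factor
`1 + C(R/ℓ)²` (and not merely a constant) is what keeps the main term `-(n(n+1)/2ℓ³)∫gω` of (2.26)
with the right constant. The "simple bound" is the second-order Taylor estimate at the maximum of
the smooth even function `χ*χ` (`(χ*χ)(0) = ∫χ² = 1`, `∇(χ*χ)(0) = 0`):

* `IsLocalizationFunction.one_sub_mul_sq_le_selfConv`: there is `C ≥ 0` with
  `1 - C|y|² ≤ (χ*χ)(y)` for all `y` (proved along rays `t ↦ (χ*χ)(ty)` by two monotonicity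
  arguments from the bound `‖D²(χ*χ)‖ ≤ M`, `C = M/2`; `χ*χ` is `C²` with compact support by
  Mathlib's `HasCompactSupport.contDiff_convolution_right`).

Consequently `1/(χ*χ)(x/ℓ) ≤ 1/(1 - C(R/ℓ)²) ≤ 1 + 2C(R/ℓ)²` for `|x| ≤ R` and `C(R/ℓ)² ≤ ½`
(`inv_selfConv_le`), which is the printed `W₁ ≤ (1 + C(R/ℓ)²)g`.

## References

* [Fournais2020] S. Fournais, *Length scales for BEC in the dilute Bose gas*, arXiv:2011.00309,
  EMS Ser. Congr. Rep. 18 (2021), doi:10.4171/ecr/18-1/7: (2.2), (2.4), (2.8), the bound before (2.42).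
-/

noncomputable section

open MeasureTheory Set
open scoped Convolution Topology

namespace Literature.MathematicalPhysics.QuantumManyBody.BoseGas

variable {χ : Space → ℝ}

/-- `χ*χ` is `C²` (indeed smooth). [cite: Fournais2020, (2.4)] -/
theorem IsLocalizationFunction.contDiff_selfConv (hχ : IsLocalizationFunction χ) : ContDiff ℝ 2 (selfConv χ) :=
  hχ.hasCompactSupport.contDiff_convolution_right _ hχ.contDiff.continuous.locallyIntegrable
    (hχ.contDiff.of_le (by norm_cast))

/-- `χ*χ` has compact support. [cite: Fournais2020, (2.4)] -/
theorem IsLocalizationFunction.hasCompactSupport_selfConv (hχ : IsLocalizationFunction χ) :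
    HasCompactSupport (selfConv χ) :=
  hχ.hasCompactSupport.convolution _ hχ.hasCompactSupport

/-- `χ*χ ≥ 0`. [cite: Fournais2020, (2.2), (2.4)] -/
theorem IsLocalizationFunction.selfConv_nonneg (hχ : IsLocalizationFunction χ) (y : Space) : 0 ≤ selfConv χ y := by
  rw [selfConv_apply]
  exact integral_nonneg fun z => mul_nonneg (hχ.nonneg _) (hχ.nonneg _)

/-- The derivative of the even function `χ*χ` vanishes at the origin. [cite: Fournais2020, (2.4)] -/
theorem IsLocalizationFunction.fderiv_selfConv_zero (hχ : IsLocalizationFunction χ) :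
    fderiv ℝ (selfConv χ) 0 = 0 := by
  have hd : DifferentiableAt ℝ (selfConv χ) 0 := hχ.contDiff_selfConv.differentiable (by norm_num) 0
  ext v
  -- along the line through `v` the function is even, so its derivative at `0` vanishes
  set φ : ℝ → ℝ := fun t => selfConv χ (t • v) with hφ
  have hray : HasDerivAt (fun t : ℝ => t • v) v 0 := by simpa using (hasDerivAt_id (0 : ℝ)).smul_const v
  have hd' : HasFDerivAt (selfConv χ) (fderiv ℝ (selfConv χ) 0) ((fun t : ℝ => t • v) 0) := by
    show HasFDerivAt (selfConv χ) (fderiv ℝ (selfConv χ) 0) ((0 : ℝ) • v)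
    rw [zero_smul]; exact hd.hasFDerivAt
  have h1 : HasDerivAt φ (fderiv ℝ (selfConv χ) 0 v) 0 := hd'.comp_hasDerivAt (0 : ℝ) hray
  have heq : φ ∘ (fun t : ℝ => -t) = φ := funext fun t => by simp [hφ, neg_smul, hχ.selfConv_neg]
  have h1' : HasDerivAt φ (fderiv ℝ (selfConv χ) 0 v) ((fun t : ℝ => -t) 0) := by
    show HasDerivAt φ (fderiv ℝ (selfConv χ) 0 v) (-(0 : ℝ))
    rw [neg_zero]; exact h1
  have h2 : HasDerivAt φ (fderiv ℝ (selfConv χ) 0 v * -1) 0 := by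
    have h := h1'.comp (0 : ℝ) (hasDerivAt_id (0 : ℝ)).neg
    rwa [heq] at h
  have h3 := h1.unique h2
  simp only [mul_neg, mul_one] at h3
  simp only [zero_apply]
  linarith

/-- **`χ*χ ≥ 1 - C|y|²`** (Taylor at the maximum: `(χ*χ)(0) = 1`, `∇(χ*χ)(0) = 0`,
`‖D²(χ*χ)‖ ≤ M`, `C = M/2`). [cite: Fournais2020, the bound `W₁ ≤ (1 + C(R/ℓ)²)g` before (2.42)] -/
theorem IsLocalizationFunction.one_sub_mul_sq_le_selfConv (hχ : IsLocalizationFunction χ) :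
    ∃ C : ℝ, 0 ≤ C ∧ ∀ y : Space, 1 - C * ‖y‖ ^ 2 ≤ selfConv χ y := by
  set F := selfConv χ with hF_def
  have hF : ContDiff ℝ 2 F := hχ.contDiff_selfConv
  have hF1 : Differentiable ℝ F := hF.differentiable (by norm_num)
  have hDF : ContDiff ℝ 1 (fderiv ℝ F) := hF.fderiv_right (m := 1) le_rfl
  have hDF1 : Differentiable ℝ (fderiv ℝ F) := hDF.differentiable one_ne_zero
  -- a bound on the second derivative (as the iterated derivative; its multilinear operator norm)
  have hD2c : Continuous (iteratedFDeriv ℝ 2 F) := hF.continuous_iteratedFDeriv le_rfl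
  have hD2s : HasCompactSupport (iteratedFDeriv ℝ 2 F) := hχ.hasCompactSupport_selfConv.iteratedFDeriv 2
  obtain ⟨M, hM⟩ := hD2s.exists_bound_of_continuous hD2c
  have hM0 : 0 ≤ M := (norm_nonneg _).trans (hM 0)
  refine ⟨M / 2, by positivity, fun y => ?_⟩
  -- the ray `g(t) = F(ty)` and its derivative `G(t) = DF(ty)y`
  set g : ℝ → ℝ := fun t => F (t • y) with hg
  set G : ℝ → ℝ := fun t => fderiv ℝ F (t • y) y with hG
  have hray : ∀ t : ℝ, HasDerivAt (fun t : ℝ => t • y) y t := fun t => by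
    simpa using (hasDerivAt_id t).smul_const y
  have hg' : ∀ t, HasDerivAt g (G t) t := fun t =>
    (hF1 (t • y)).hasFDerivAt.comp_hasDerivAt t (hray t)
  have hG' : ∀ t, HasDerivAt G ((fderiv ℝ (fderiv ℝ F) (t • y) y) y) t := by
    intro t
    have hc : HasFDerivAt (fun x : Space => fderiv ℝ F x y)
        ((fderiv ℝ F (t • y)).comp (0 : Space →L[ℝ] Space) + (fderiv ℝ (fderiv ℝ F) (t • y)).flip y) (t • y) :=
      (hDF1 (t • y)).hasFDerivAt.clm_apply (hasFDerivAt_const y (t • y))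
    have h := hc.comp_hasDerivAt t (hray t)
    refine h.congr_deriv ?_
    simp [ContinuousLinearMap.flip_apply]
  have hG'bound : ∀ t : ℝ, -(M * ‖y‖ ^ 2) ≤ (fderiv ℝ (fderiv ℝ F) (t • y) y) y := by
    intro t
    have h1 : ‖(fderiv ℝ (fderiv ℝ F) (t • y) y) y‖ ≤ M * ‖y‖ ^ 2 := by
      have heq : (fderiv ℝ (fderiv ℝ F) (t • y) y) y = iteratedFDeriv ℝ 2 F (t • y) ![y, y] := by
        rw [iteratedFDeriv_two_apply]; rfl
      rw [heq]
      calc ‖iteratedFDeriv ℝ 2 F (t • y) ![y, y]‖ ≤ ‖iteratedFDeriv ℝ 2 F (t • y)‖ * (‖y‖ * ‖y‖) := by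
            refine (ContinuousMultilinearMap.le_opNorm _ _).trans_eq ?_
            simp [Fin.prod_univ_two]
        _ ≤ M * (‖y‖ * ‖y‖) := by gcongr; exact hM _
        _ = M * ‖y‖ ^ 2 := by ring
    rw [Real.norm_eq_abs] at h1
    linarith [neg_abs_le ((fderiv ℝ (fderiv ℝ F) (t • y) y) y)]
  have hG0 : G 0 = 0 := by simp [hG, hχ.fderiv_selfConv_zero, hF_def]
  have hg0 : g 0 = 1 := by simp [hg, hF_def, hχ.selfConv_zero]
  -- Step A: `G(t) ≥ -M|y|² t` on `[0, 1]`
  have hA : ∀ t ∈ Icc (0 : ℝ) 1, -(M * ‖y‖ ^ 2) * t ≤ G t := by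
    intro t ht
    have hd : ∀ t : ℝ, HasDerivAt (fun t => G t + M * ‖y‖ ^ 2 * t)
        ((fderiv ℝ (fderiv ℝ F) (t • y) y) y + M * ‖y‖ ^ 2) t := fun t => by
      simpa using (hG' t).fun_add ((hasDerivAt_id t).const_mul (M * ‖y‖ ^ 2))
    have hmono : MonotoneOn (fun t => G t + M * ‖y‖ ^ 2 * t) (Icc 0 1) := by
      refine monotoneOn_of_deriv_nonneg (convex_Icc 0 1) (HasDerivAt.continuousOn fun t _ => hd t)
        (fun t _ => (hd t).differentiableAt.differentiableWithinAt) fun t _ => ?_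
      rw [(hd t).deriv]
      linarith [hG'bound t]
    have h := hmono (left_mem_Icc.mpr zero_le_one) ht ht.1
    simp only [hG0, mul_zero, add_zero] at h
    linarith
  -- Step B: `g(t) + M|y|²t²/2` is non-decreasing, so `g(1) ≥ g(0) - M|y|²/2`
  have hB : MonotoneOn (fun t => g t + M * ‖y‖ ^ 2 / 2 * t ^ 2) (Icc 0 1) := by
    have hd : ∀ t, HasDerivAt (fun t => g t + M * ‖y‖ ^ 2 / 2 * t ^ 2) (G t + M * ‖y‖ ^ 2 / 2 * (2 * t)) t := by
      intro t
      have h2 : HasDerivAt (fun t : ℝ => t ^ 2) (2 * t) t := by simpa using hasDerivAt_pow 2 t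
      exact (hg' t).fun_add (h2.const_mul _)
    refine monotoneOn_of_deriv_nonneg (convex_Icc 0 1) (HasDerivAt.continuousOn fun t _ => hd t)
      (fun t _ => (hd t).differentiableAt.differentiableWithinAt) fun t ht => ?_
    rw [interior_Icc] at ht
    rw [(hd t).deriv]
    have := hA t ⟨ht.1.le, ht.2.le⟩
    nlinarith
  have h := hB (left_mem_Icc.mpr zero_le_one) (right_mem_Icc.mpr zero_le_one) zero_le_one
  simp only [hg, one_smul, one_pow, mul_one, ne_eq, OfNat.ofNat_ne_zero, not_false_eq_true, zero_pow,
    mul_zero, add_zero] at h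
  rw [hF_def] at h
  linarith

/-- **The printed consequence**: for `|x| ≤ R` and `C(R/ℓ)² ≤ ½`, `1/(χ*χ)(x/ℓ) ≤ 1 + 2C(R/ℓ)²`
(so `W₁ = g/(χ*χ)(x/ℓ) ≤ (1 + 2C(R/ℓ)²) g` on `supp g ⊂ B(0,R)`). [cite: Fournais2020, the bound before (2.42)] -/
theorem inv_selfConv_le {C R ℓ : ℝ} (hC : 0 ≤ C) (hℓ : 0 < ℓ) (hχC : ∀ y : Space, 1 - C * ‖y‖ ^ 2 ≤ selfConv χ y)
    (hsmall : C * (R / ℓ) ^ 2 ≤ 1 / 2) {x : Space} (hx : ‖x‖ ≤ R) :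
    0 < selfConv χ (ℓ⁻¹ • x) ∧ (selfConv χ (ℓ⁻¹ • x))⁻¹ ≤ 1 + 2 * C * (R / ℓ) ^ 2 := by
  have hR : 0 ≤ R := (norm_nonneg x).trans hx
  have hy : ‖ℓ⁻¹ • x‖ ≤ R / ℓ := by
    rw [norm_smul, Real.norm_of_nonneg (inv_nonneg.mpr hℓ.le), div_eq_inv_mul]
    exact mul_le_mul_of_nonneg_left hx (inv_nonneg.mpr hℓ.le)
  have hy2 : C * ‖ℓ⁻¹ • x‖ ^ 2 ≤ C * (R / ℓ) ^ 2 := by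
    gcongr
  have hlow : 1 - C * (R / ℓ) ^ 2 ≤ selfConv χ (ℓ⁻¹ • x) := by linarith [hχC (ℓ⁻¹ • x)]
  have hpos : 0 < selfConv χ (ℓ⁻¹ • x) := by linarith
  refine ⟨hpos, ?_⟩
  rw [inv_le_comm₀ hpos (by positivity)]
  -- `1/(1 + 2u) ≤ 1 - u` for `0 ≤ u ≤ ½`, `u = C(R/ℓ)²`
  set u := C * (R / ℓ) ^ 2 with hu
  have hu0 : 0 ≤ u := by positivity
  calc (1 + 2 * C * (R / ℓ) ^ 2)⁻¹ = (1 + 2 * u)⁻¹ := by rw [hu]; ring_nf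
    _ ≤ 1 - u := by
        rw [inv_eq_one_div, div_le_iff₀ (by positivity)]
        nlinarith
    _ ≤ selfConv χ (ℓ⁻¹ • x) := hlow

end Literature.MathematicalPhysics.QuantumManyBody.BoseGas

end
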